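import Summits.ResolutionOfSingularities.ResolutionOfSingularities.Theorems.WeightedInvariantWeightedThesisHypersurfaceModelInfinite
import HarnessLib

/-!
# `EquisingularLift.HypersurfacesSuffice` (crux stmt-ResolutionOfSingularities-15964), line
# `generic-projection-closure`, stub S1: generic linear forms

Stub `stub_exists_linearForms` of the lead's skeleton for the crux `HypersurfacesSuffice` (shared by
the routes `EquisingularLift` and `TeissierJung`). PROVED here: for an integral closed `X ⊆ ℙⁿ_k` over
an infinite perfect field `k` there are `d = dim X` and linear forms `t₀, …, t_{d+1}` on `ℙⁿ` with
`t₀, …, t_d` without common zero on `X`, `t₀ ≢ 0` on `X`, and `K(X) = k(t₁/t₀, …, t_{d+1}/t₀)`.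

This is exactly the content of the landed assembly
`WeightedThesis.HypersurfaceModel.hypersurfaceModel_infinite_of_stubs`
(file `…WeightedInvariantWeightedThesisHypersurfaceModelAssembly`), re-concluded one step before its
last line, and fed — as in `WeightedThesis.HypersurfaceModel.stub_hypersurfaceModel_infinite` — with
the three landed sub-stubs `stub_functionFieldKaehler` (`dim Ω[K(X)⁄k] = dim X`, `k` perfect),
`stub_formFnLinearGenerates` (ratios of linear forms generate `K(X)`) and
`stub_genericFormsNoCommonZero` (sequentially generic linear forms without common zero).

Proof: the choice of `t₀, …, t_{d+1}` is sequential and generic: `t₁/t₀, …, t_d/t₀` are chosen with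
linearly independent differentials in `Ω[K(X)⁄k]` (`FieldCore.isGeneric_D_not_mem_span`), hence
form a separating transcendence basis, and `t_{d+1}/t₀` is chosen primitive for the finite separable
extension `K(X)/k(t₁/t₀, …, t_d/t₀)` (`FieldCore.isGeneric_adjoin_simple_eq_top`); then
`K(X) = k(t_a/t₀ : a ≤ d + 1)`.

## References

* J. Kollár, *Lectures on Resolution of Singularities* (2007), proof of Prop. 2.48. [Kollar2007]
* R. Hartshorne, *Algebraic Geometry* (1977), I Prop. 4.9. [Hartshorne1977]
-/

noncomputable section

set_option linter.dupNamespace false -- mandated namespace of this single-conjunct summit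

open CategoryTheory AlgebraicGeometry
open Literature.AlgebraicGeometry.Resolution Literature.AlgebraicGeometry.Motives
open Summit.ResolutionOfSingularities.ResolutionOfSingularities.Theorems.WeightedThesis

namespace Summit.ResolutionOfSingularities.ResolutionOfSingularities.Theorems.HypersurfacesSuffice

/-- **S1 — generic linear forms.** For an integral closed `X ⊆ ℙⁿ_k` over an infinite perfect
field `k` there are `d = dim X` and linear forms `t₀, …, t_{d+1}` with `t₀, …, t_d` without common
zero on `X`, `t₀ ≢ 0` on `X`, and `K(X) = k(t₁/t₀, …, t_{d+1}/t₀)` (separating transcendence basis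
from `dim Ω[K(X)⁄k] = d` plus a primitive element, all generic).
[cite: Kollar2007, Prop. 2.48 (proof); Hartshorne1977, I Prop. 4.9] -/
theorem stub_exists_linearForms : ∀ (k : Type) [Field k] [PerfectField k] [Infinite k] (n : ℕ) (X : AlgebraicGeometry.Scheme.{0}) (ι : X ⟶ (Literature.AlgebraicGeometry.Motives.projectiveSpace n k).left) [AlgebraicGeometry.IsClosedImmersion ι] [AlgebraicGeometry.IsIntegral X], ∃ (d : ℕ) (t : Fin (d + 1 + 1) → Fin (n + 1) → k), Literature.AlgebraicGeometry.Resolution.LinSec.NoCommonZero ι (Literature.AlgebraicGeometry.Resolution.LinSec.tInit t) ∧ Literature.AlgebraicGeometry.Resolution.LinSec.formFn ι (t 0) ≠ 0 ∧ topologicalKrullDim X = d ∧ Subfield.closure (Set.range ((X.presheaf.germ ⊤ (genericPoint X) trivial).hom.comp ((ι ≫ (Literature.AlgebraicGeometry.Motives.projectiveSpace n k).hom).appTop.hom.comp (AlgebraicGeometry.Scheme.ΓSpecIso (.of k)).inv.hom)) ∪ Set.range (fun a : Fin (d + 1) => Literature.AlgebraicGeometry.Resolution.LinSec.formFn ι (t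 a.succ) / Literature.AlgebraicGeometry.Resolution.LinSec.formFn ι (t 0))) = ⊤ := by
  intro k _ _ _ n X ι hι hX
  classical
  -- the `k`-algebra structure on `K(X)`
  let φk : k →+* X.functionField := (X.presheaf.germ ⊤ (genericPoint X) trivial).hom.comp
    ((ι ≫ (Literature.AlgebraicGeometry.Motives.projectiveSpace n k).hom).appTop.hom.comp
      (AlgebraicGeometry.Scheme.ΓSpecIso (.of k)).inv.hom)
  letI : Algebra k X.functionField := φk.toAlgebra
  have halg : algebraMap k X.functionField = φk := rfl
  -- F1: `Ω[K(X)⁄k]` has dimension `d = dim X`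
  obtain ⟨hEss, hFin, d, hdim, hrank⟩ := HypersurfaceModel.stub_functionFieldKaehler k X
    (ι ≫ (Literature.AlgebraicGeometry.Motives.projectiveSpace n k).hom) halg
  haveI := hEss
  haveI := hFin
  -- F2: the linear map of forms, whose ratios generate `K(X)`
  obtain ⟨V, hV, hgenV⟩ := HypersurfaceModel.stub_formFnLinearGenerates k n X ι halg
  -- the generic side conditions: given the denominator form `a0` (non-zero on `X`) and the previous
  -- numerator forms `as : Fin m → _`, the next form `b` has `d(V b / t₀)` off the span of the previous
  -- differentials while `m < d`, and `V b / t₀` primitive over `k(previous ratios)` when `m = d`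
  let Dk : X.functionField → Ω[X.functionField⁄k] := fun x => KaehlerDifferential.D k X.functionField x
  let Q : (Fin (n + 1) → k) → (m : ℕ) → (Fin m → Fin (n + 1) → k) → (Fin (n + 1) → k) → Prop :=
    fun a0 m as b =>
      LinSec.formFn ι a0 ≠ 0 →
        (m < d → LinearIndependent X.functionField (fun i : Fin m => Dk (V (as i) / LinSec.formFn ι a0)) →
          Dk (V b / LinSec.formFn ι a0) ∉ Submodule.span X.functionField
            (Set.range fun i : Fin m => Dk (V (as i) / LinSec.formFn ι a0))) ∧
        (m = d → LinearIndependent X.functionField (fun i : Fin m => Dk (V (as i) / LinSec.formFn ι a0)) →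
          IntermediateField.adjoin (IntermediateField.adjoin k
            (Set.range fun i : Fin m => V (as i) / LinSec.formFn ι a0)) {V b / LinSec.formFn ι a0} = ⊤)
  have hQ : ∀ (a0 : Fin (n + 1) → k) (m : ℕ) (as : Fin m → Fin (n + 1) → k), IsGeneric (Q a0 m as) := by
    intro a0 m as
    by_cases h0 : LinSec.formFn ι a0 = 0
    · exact IsGeneric.of_forall fun b hne => absurd h0 hne
    have hgen0 := hgenV a0 h0
    have hA : IsGeneric fun b : Fin (n + 1) → k =>
        m < d → LinearIndependent X.functionField (fun i : Fin m => Dk (V (as i) / LinSec.formFn ι a0)) →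
          Dk (V b / LinSec.formFn ι a0) ∉ Submodule.span X.functionField
            (Set.range fun i : Fin m => Dk (V (as i) / LinSec.formFn ι a0)) := by
      by_cases hmd : m < d
      · have hm : m < Module.finrank X.functionField (Ω[X.functionField⁄k]) := by rw [hrank]; exact hmd
        exact (HypersurfaceModel.FieldCore.isGeneric_D_not_mem_span V (LinSec.formFn ι a0) hgen0
          (fun i : Fin m => V (as i) / LinSec.formFn ι a0) hm).mono fun b hb _ _ => hb
      · exact IsGeneric.of_forall fun b h => absurd h hmd
    have hB : IsGeneric fun b : Fin (n + 1) → k =>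
        m = d → LinearIndependent X.functionField (fun i : Fin m => Dk (V (as i) / LinSec.formFn ι a0)) →
          IntermediateField.adjoin (IntermediateField.adjoin k
            (Set.range fun i : Fin m => V (as i) / LinSec.formFn ι a0)) {V b / LinSec.formFn ι a0} = ⊤ := by
      by_cases hmd : m = d
      · by_cases hli : LinearIndependent X.functionField
            (fun i : Fin m => Dk (V (as i) / LinSec.formFn ι a0))
        · have hd' : Module.finrank X.functionField (Ω[X.functionField⁄k]) = m := by rw [hrank, hmd]
          exact (HypersurfaceModel.FieldCore.isGeneric_adjoin_simple_eq_top V (LinSec.formFn ι a0) hgen0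
            (fun i : Fin m => V (as i) / LinSec.formFn ι a0) hli hd').mono fun b hb _ _ => hb
        · exact IsGeneric.of_forall fun b _ h => absurd h hli
      · exact IsGeneric.of_forall fun b h => absurd h hmd
    exact (hA.and hB).mono fun b hb _ => hb
  let P : ∀ j : ℕ, (Fin j → Fin (n + 1) → k) → (Fin (n + 1) → k) → Prop := fun j a b =>
    ∀ hj : 0 < j, Q (a ⟨0, hj⟩) (j - 1) (fun i : Fin (j - 1) => a ⟨i.1 + 1, by omega⟩) b
  have hP : ∀ (j : ℕ) (a : Fin j → Fin (n + 1) → k), IsGeneric (P j a) := by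
    intro j a
    by_cases hj : 0 < j
    · exact (hQ (a ⟨0, hj⟩) (j - 1) (fun i : Fin (j - 1) => a ⟨i.1 + 1, by omega⟩)).mono
        fun b hb _ => hb
    · exact IsGeneric.of_forall fun b hj' => absurd hj' hj
  -- F3: the sequence of forms
  obtain ⟨t, ht, hbpf, ht0⟩ :=
    HypersurfaceModel.stub_genericFormsNoCommonZero k n X ι d hdim P hP
  -- consequences along the sequence
  have hstep : ∀ (m : ℕ) (hm : m ≤ d),
      Q (t 0) m (fun i : Fin m => t ⟨i.1 + 1, by omega⟩) (t ⟨m + 1, by omega⟩) := by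
    intro m hm
    exact ht (m + 1) (by omega) (Nat.succ_pos m)
  -- the ratios `t₁/t₀, …, t_d/t₀` have independent differentials
  have hli : ∀ (m : ℕ) (hm : m ≤ d), LinearIndependent X.functionField
      (fun i : Fin m => Dk (V (t ⟨i.1 + 1, by omega⟩) / LinSec.formFn ι (t 0))) := by
    intro m
    induction m with
    | zero => intro _; exact linearIndependent_empty_type
    | succ m ih =>
      intro hm
      have hnot := (hstep m (by omega) ht0).1 (by omega) (ih (by omega))
      have e : (fun i : Fin (m + 1) => Dk (V (t ⟨i.1 + 1, by omega⟩) / LinSec.formFn ι (t 0))) =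
          Fin.snoc (fun i : Fin m => Dk (V (t ⟨i.1 + 1, by omega⟩) / LinSec.formFn ι (t 0)))
            (Dk (V (t ⟨m + 1, by omega⟩) / LinSec.formFn ι (t 0))) := by
        funext i
        refine Fin.lastCases ?_ (fun i => ?_) i
        · simp only [Fin.snoc_last, Fin.val_last]
        · simp only [Fin.snoc_castSucc, Fin.val_castSucc]
      rw [e, linearIndependent_finSnoc]
      exact ⟨ih (by omega), hnot⟩
  -- `t_{d+1}/t₀` is a primitive element over `k(t₁/t₀, …, t_d/t₀)`
  have hprim := (hstep d le_rfl ht0).2 rfl (hli d le_rfl)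
  -- hence `K(X) = k(t_a/t₀ : 1 ≤ a ≤ d + 1)`
  have hgen : Subfield.closure
      (Set.range ((X.presheaf.germ ⊤ (genericPoint X) trivial).hom.comp
        ((ι ≫ (Literature.AlgebraicGeometry.Motives.projectiveSpace n k).hom).appTop.hom.comp
          (AlgebraicGeometry.Scheme.ΓSpecIso (.of k)).inv.hom)) ∪
        Set.range (fun a : Fin (d + 1) => LinSec.formFn ι (t a.succ) / LinSec.formFn ι (t 0))) = ⊤ := by
    -- the set of all ratios contains the previous ones and the last one
    set R : Set X.functionField :=
      Set.range (fun a : Fin (d + 1) => LinSec.formFn ι (t a.succ) / LinSec.formFn ι (t 0)) with hR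
    have hsub : (Set.range fun i : Fin d => V (t ⟨i.1 + 1, by omega⟩) / LinSec.formFn ι (t 0)) ∪
        {V (t ⟨d + 1, by omega⟩) / LinSec.formFn ι (t 0)} ⊆ R := by
      rintro x (⟨i, rfl⟩ | hx)
      · refine ⟨⟨i.1, by omega⟩, ?_⟩
        simp only [hV]
        rfl
      · rw [Set.mem_singleton_iff] at hx
        subst hx
        refine ⟨Fin.last d, ?_⟩
        simp only [hV]
        rfl
    have htop : IntermediateField.adjoin k R = ⊤ := by
      rw [eq_top_iff]
      have h1 : IntermediateField.adjoin k
          ((Set.range fun i : Fin d => V (t ⟨i.1 + 1, by omega⟩) / LinSec.formFn ι (t 0)) ∪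
            {V (t ⟨d + 1, by omega⟩) / LinSec.formFn ι (t 0)}) = ⊤ := by
        rw [← IntermediateField.adjoin_adjoin_left, hprim, IntermediateField.restrictScalars_top]
      rw [← h1]
      exact IntermediateField.adjoin.mono k _ _ hsub
    have h2 := congrArg IntermediateField.toSubfield htop
    rw [IntermediateField.adjoin_toSubfield] at h2
    exact h2
  exact ⟨d, t, hbpf, ht0, hdim, hgen⟩

end Summit.ResolutionOfSingularities.ResolutionOfSingularities.Theorems.HypersurfacesSuffice

end
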